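import Mathlib
import Summits.PneNP.PneNP.Theorems.SymmetryBudgetWindowBarrierESTArith
import Summits.PneNP.PneNP.Theorems.SymmetryBudgetWindowBarrierESTLinkage
import Summits.PneNP.PneNP.Theorems.SymmetryBudgetWindowBarrierESTBlocks
import Summits.PneNP.PneNP.Theorems.SymmetryBudgetWindowBarrierESTTransport

/-!
# Entropy support theorem, layer 6: the transitive pair bound

Helper file for stub `entropySupportTheorem` of crux `SymmetryBudget.WindowBarrier`
(item stmt-PneNP-2145, line `bijection-gauge-twin-iso`).

**`est_transitive_pair_bound`.**  Let `T ≤ Sym(β)` be transitive (`|β| = d`) and let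
`X, Y, Z ≤ T` be normalised by `T` with `[X, Y] ⊆ Z`.  Then there is a labelling `μ` of `β` such
that every even permutation of `β` whose moved points carry one label lies in `Z`, and
`|X| · |Y| ≤ 2^{5d} · d! · ∏_classes |class|!`.

Proof.  Take a block `B` of minimal size `a ≥ 2` (`b` translates, `ab = d`), `K` the kernel of the
action on the translates (`|X| ≤ b! |X ∩ K|`), `P ≤ Sym(B)` the primitive group induced by `T_B`.
* If `a ≤ 4` or `Alt(B) ⊄ P`: Bochert gives `|P|² ≤ 2^{5a} a!`, and `|K| ≤ |P|^b`, so
  `|X||Y| ≤ (b!)² |P|^{2b} ≤ 2^{5d} (a!)^b (b!)² ≤ 2^{5d} d!` (singleton classes).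
* Else `X ∩ K`, `Y ∩ K` are trivial or full on `B` (layer 2), hence on every translate.  If one is
  trivial it is `1` and `|X||Y| ≤ (b!)² (a!)^b ≤ d!`.  If both are full, look at the elements of
  `Z ∩ K` supported in `B`: either they induce `Alt(B)` — then `Z` contains every even permutation
  supported in a translate, the classes are the translates and
  `|X||Y| ≤ (b!)² (a!)^{2b} ≤ d! (a!)^b` — or there are none, on any translate; then a rigid element
  of `X ∩ K` on a translate `C` would have a non-trivial commutator in `Z ∩ K` supported in `C`
  with a suitable element of `Y ∩ K` (full on `C`), so no translate is *good* and the linkage count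
  (layer 3) gives `|X ∩ K|², |Y ∩ K|² ≤ (a!)^b`, whence `|X||Y| ≤ (b!)² (a!)^b ≤ d!`.

No definitions (kernel-only helper file).
-/

-- `Summit.PneNP.PneNP.…` duplicates `PneNP` BY DESIGN (single-problem summit).
set_option linter.dupNamespace false

namespace Summit.PneNP.PneNP.Theorems

open Equiv Equiv.Perm MulAction Subgroup
open Literature.GroupTheory.PermutationGroups (restr restr_apply_coe perm_apply_inv_self
  perm_inv_apply_self)
open scoped Pointwise Classical

namespace EST

variable {β : Type*} [Fintype β] [DecidableEq β]

/-- If the induced group contains `Alt(B)`, the stabiliser `T_B` is *full* on `B`: every even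
permutation of `β` supported in `B` agrees on `B` with an element of `T_B`. -/
theorem stabilizer_full_of_alternating_le (T : Subgroup (Perm β)) (B : Finset β)
    (hAlt : alternatingGroup {u // u ∈ B} ≤
      (restr ((stabilizer T B).map T.subtype) (fun u => u ∈ B) (stabilizer_apply_mem_iff T B)).range) :
    ∀ σ : Perm β, sign σ = 1 → (∀ u, σ u ≠ u → u ∈ B) →
      ∃ t ∈ (stabilizer T B).map T.subtype, ∀ u ∈ B, t u = σ u := by
  intro σ hσ hσB
  have hσp : ∀ u, σ u ∈ B ↔ u ∈ B := apply_mem_iff_of_moved_subset hσB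
  have hsa : sign (σ.subtypePerm hσp) = 1 := by
    have h := sign_subtypePerm σ hσp hσB
    rw [hσ] at h
    convert h using 3
  obtain ⟨t, ht⟩ := hAlt (Perm.mem_alternatingGroup.2 hsa)
  refine ⟨t, t.2, fun u hu => ?_⟩
  have := congrArg (fun f : Perm {u // u ∈ B} => ((f ⟨u, hu⟩ : {u // u ∈ B}) : β)) ht
  simpa using this

/-- Bochert for the induced group: if it is primitive and does not contain `Alt(B)`, then
`⌊(|B|+1)/2⌋! · |P| ≤ |B|!`; in any case `|P| ≤ |B|!`. -/
theorem card_induced_le (T : Subgroup (Perm β)) (B : Finset β) :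
    Nat.card ↥(restr ((stabilizer T B).map T.subtype) (fun u => u ∈ B)
        (stabilizer_apply_mem_iff T B)).range ≤ B.card.factorial ∧
    (IsPreprimitive ↥(restr ((stabilizer T B).map T.subtype) (fun u => u ∈ B)
        (stabilizer_apply_mem_iff T B)).range {u // u ∈ B} →
      ¬ alternatingGroup {u // u ∈ B} ≤
        (restr ((stabilizer T B).map T.subtype) (fun u => u ∈ B) (stabilizer_apply_mem_iff T B)).range →
      ((B.card + 1) / 2).factorial *
        Nat.card ↥(restr ((stabilizer T B).map T.subtype) (fun u => u ∈ B)
          (stabilizer_apply_mem_iff T B)).range ≤ B.card.factorial) := by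
  set P := (restr ((stabilizer T B).map T.subtype) (fun u => u ∈ B) (stabilizer_apply_mem_iff T B)).range
    with hP
  have hidx : P.index * Nat.card P = B.card.factorial := by
    rw [Subgroup.index_mul_card, Nat.card_perm, Nat.card_eq_fintype_card, Fintype.card_coe]
  refine ⟨?_, fun hprim hAlt => ?_⟩
  · calc Nat.card P ≤ Nat.card (Perm {u // u ∈ B}) := Nat.card_le_card_of_injective _ Subtype.val_injective
      _ = B.card.factorial := by rw [Nat.card_perm, Nat.card_eq_fintype_card, Fintype.card_coe]
  · have hb := Literature.GroupTheory.PermutationGroups.Bochert.factorial_half_le_index P hprim hAlt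
    rw [Fintype.card_coe] at hb
    rw [← hidx]
    exact Nat.mul_le_mul_right _ hb

end EST

open EST in
/-- **No good translate.**  In a transitive `T` with block `B`, kernel `K`, let `U, V ≤ K` with
`V` full on every translate, `[U, V] ⊆ W` for a subgroup `W` having no non-trivial element
supported in a single translate.  Then no non-trivial element of `U` is supported in a single
translate. -/
theorem est_no_rigid_of_commutator {β : Type*} [Fintype β] [DecidableEq β]
    (T : Subgroup (Perm β)) [IsPretransitive T β] (B : Finset β) (h4 : 4 ≤ B.card)
    (U V W : Subgroup (Perm β))
    (hUK : U ≤ ((MulAction.toPermHom T (orbit T B)).ker).map T.subtype)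
    (hVK : V ≤ ((MulAction.toPermHom T (orbit T B)).ker).map T.subtype)
    (hVfull : ∀ C ∈ orbit T B, ∀ σ : Perm β, sign σ = 1 → (∀ u, σ u ≠ u → u ∈ C) →
      ∃ y ∈ V, ∀ u ∈ C, y u = σ u)
    (hcUV : ∀ x ∈ U, ∀ y ∈ V, x * y * x⁻¹ * y⁻¹ ∈ W)
    (hrig : ∀ C ∈ orbit T B, ∀ z ∈ W, (∀ u, u ∉ C → z u = u) → z = 1) :
    ∀ C ∈ orbit T B, ∀ x ∈ U, x ≠ 1 → ¬ ∀ u, u ∉ C → x u = u := by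
  intro C hC x hxU hx1 hxoff
  obtain ⟨u, hu⟩ : ∃ u, x u ≠ u := by
    by_contra h
    push Not at h
    exact hx1 (Equiv.ext h)
  have huC : u ∈ C := by by_contra h; exact hu (hxoff u h)
  have hCcard : 4 ≤ C.card := by rw [card_eq_of_mem_orbit T B hC]; exact h4
  obtain ⟨τ, hτ3, hτC, hτx⟩ := exists_isThreeCycle_not_commute C hCcard x u huC hu
  obtain ⟨y, hyV, hyτ⟩ := hVfull C hC τ hτ3.sign hτC
  have hcoff : ∀ w, w ∉ C → (x * y * x⁻¹ * y⁻¹) w = w := by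
    intro w hw
    have h1 : y⁻¹ w ∉ C := fun h => hw (by
      have := kernel_apply_mem_iff T B (hVK hyV) hC (y⁻¹ w)
      rw [perm_apply_inv_self] at this
      exact this.2 h)
    have h2 : x⁻¹ (y⁻¹ w) = y⁻¹ w := by rw [Perm.inv_eq_iff_eq]; exact (hxoff _ h1).symm
    rw [Perm.mul_apply, Perm.mul_apply, Perm.mul_apply, h2, perm_apply_inv_self, hxoff w hw]
  have hc1 : x * y * x⁻¹ * y⁻¹ = 1 := hrig C hC _ (hcUV x hxU y hyV) hcoff
  have hxy : x * y = y * x := by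
    rw [mul_inv_eq_one, mul_inv_eq_iff_eq_mul] at hc1
    exact hc1
  apply hτx
  ext v
  rw [Perm.mul_apply, Perm.mul_apply]
  by_cases hv : v ∈ C
  · have hxv : x v ∈ C := (kernel_apply_mem_iff T B (hUK hxU) hC v).2 hv
    have := congrArg (fun f : Perm β => f v) hxy
    simp only [Perm.mul_apply] at this
    rw [← hyτ _ hxv, ← hyτ v hv, this]
  · rw [hxoff v hv, apply_eq_self_of_not_mem hτC v hv]
    exact (hxoff v hv).symm

open EST in
/-- **The transitive pair bound** (see the module docstring). -/
theorem est_transitive_pair_bound :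
    ∀ {β : Type*} [Fintype β] [DecidableEq β] (T X Y Z : Subgroup (Equiv.Perm β)),
      MulAction.IsPretransitive T β → X ≤ T → Y ≤ T →
      (∀ t ∈ T, ∀ x ∈ X, t * x * t⁻¹ ∈ X) → (∀ t ∈ T, ∀ y ∈ Y, t * y * t⁻¹ ∈ Y) →
      (∀ t ∈ T, ∀ z ∈ Z, t * z * t⁻¹ ∈ Z) → (∀ x ∈ X, ∀ y ∈ Y, x * y * x⁻¹ * y⁻¹ ∈ Z) →
      ∃ (N : ℕ) (μ : β → ℕ), (∀ u, μ u < N) ∧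
        (∀ σ : Equiv.Perm β, Equiv.Perm.sign σ = 1 → (∀ u v, σ u ≠ u → σ v ≠ v → μ u = μ v) →
          σ ∈ Z) ∧
        Nat.card X * Nat.card Y ≤ 2 ^ (5 * Fintype.card β) * (Fintype.card β).factorial *
          ∏ i ∈ Finset.range N, ((Finset.univ.filter fun u : β => μ u = i).card).factorial := by
  intro β _ _ T X Y Z htrans hXT hYT nX nY nZ hc
  haveI := htrans
  set d := Fintype.card β with hd
  have hpos : 1 ≤ 2 ^ (5 * d) * d.factorial := Nat.mul_pos (Nat.pow_pos (by norm_num)) (Nat.factorial_pos d)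
  -- the singleton labelling closes every case but one
  obtain ⟨μ₁, hμ₁inj, hμ₁lt⟩ := exists_injective_labelling β
  have single : ∀ bound : ℕ, Nat.card X * Nat.card Y ≤ bound → bound ≤ 2 ^ (5 * d) * d.factorial →
      ∃ (N : ℕ) (μ : β → ℕ), (∀ u, μ u < N) ∧
        (∀ σ : Perm β, sign σ = 1 → (∀ u v, σ u ≠ u → σ v ≠ v → μ u = μ v) → σ ∈ Z) ∧
        Nat.card X * Nat.card Y ≤ 2 ^ (5 * d) * d.factorial *
          ∏ i ∈ Finset.range N, ((Finset.univ.filter fun u : β => μ u = i).card).factorial := by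
    intro bound h1 h2
    refine ⟨d, μ₁, hμ₁lt, fun σ _ hσ => ?_, ?_⟩
    · rw [eq_one_of_moved_subsingleton σ fun u v hu hv => hμ₁inj (hσ u v hu hv)]
      exact Z.one_mem
    · rw [prod_eq_one_of_injective μ₁ hμ₁inj, mul_one]
      exact h1.trans h2
  ------------------------------------------------------------------ degenerate degrees
  by_cases hd1 : d ≤ 1
  · have hsub : ∀ S : Subgroup (Perm β), Nat.card S ≤ 1 := fun S =>
      calc Nat.card S ≤ Nat.card (Perm β) := Nat.card_le_card_of_injective _ Subtype.val_injective
        _ = d.factorial := by rw [Nat.card_perm, Nat.card_eq_fintype_card]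
        _ = 1 := Nat.factorial_eq_one.2 hd1
    exact single 1 (by simpa using Nat.mul_le_mul (hsub X) (hsub Y)) hpos
  push Not at hd1
  ------------------------------------------------------------------ a minimal block
  set S : Finset (Finset β) := Finset.univ.filter fun C => IsBlock T (C : Set β) ∧ 2 ≤ C.card with hS
  have hSne : S.Nonempty := ⟨Finset.univ, by
    rw [hS, Finset.mem_filter, Finset.coe_univ, Finset.card_univ]
    exact ⟨Finset.mem_univ _, IsBlock.univ, by omega⟩⟩
  obtain ⟨B, hBS, hBmin⟩ := Finset.exists_min_image S Finset.card hSne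
  rw [hS, Finset.mem_filter] at hBS
  obtain ⟨-, hB, ha2⟩ := hBS
  have hmin : ∀ C : Finset β, IsBlock T (C : Set β) → 2 ≤ C.card → B.card ≤ C.card :=
    fun C hC h2 => hBmin C (by rw [hS, Finset.mem_filter]; exact ⟨Finset.mem_univ _, hC, h2⟩)
  have hBne : B.Nonempty := Finset.card_pos.1 (by omega)
  set a := B.card with ha
  set b := Nat.card (orbit T B) with hb
  have hab : a * b = d := (Literature.GroupTheory.PermutationGroups.card_le_of_isBlock T B hBne hB).1
  set K := ((MulAction.toPermHom T (orbit T B)).ker).map T.subtype with hK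
  set TB := (stabilizer T B).map T.subtype with hTB
  set P := (restr TB (fun u => u ∈ B) (stabilizer_apply_mem_iff T B)).range with hP
  haveI hPprim : IsPreprimitive P {u // u ∈ B} := isPreprimitive_of_minimal T B hB hmin
  have hXK := card_le_factorial_mul_card_inf_kernel T B X hXT
  have hYK := card_le_factorial_mul_card_inf_kernel T B Y hYT
  have hKa : ∀ N : Subgroup (Perm β), N ≤ K → Nat.card N ≤ a.factorial ^ b :=
    fun N hN => card_le_pow_of_le_kernel T B hBne N hN
  have hA1 : a.factorial ^ b * b.factorial ^ 2 ≤ d.factorial := by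
    rw [← hab]; exact est_factorial_pow_mul_factorial_sq_le a b ha2
  -- the bound `(b!)² (a!)^b ≤ d!`, used three times
  have hsmall : ∀ x y : ℕ, x ≤ a.factorial ^ b → y ≤ a.factorial ^ b → x * y ≤ a.factorial ^ b →
      (b.factorial * x) * (b.factorial * y) ≤ 2 ^ (5 * d) * d.factorial := by
    intro x y _ _ hxy
    calc (b.factorial * x) * (b.factorial * y) = (x * y) * b.factorial ^ 2 := by ring
      _ ≤ a.factorial ^ b * b.factorial ^ 2 := Nat.mul_le_mul_right _ hxy
      _ ≤ d.factorial := hA1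
      _ ≤ 2 ^ (5 * d) * d.factorial := Nat.le_mul_of_pos_left _ (Nat.pow_pos (by norm_num))
  ------------------------------------------------------------------ case I: small block group
  by_cases hI : a ≤ 4 ∨ ¬ alternatingGroup {u // u ∈ B} ≤ P
  · have hP2 : Nat.card P ^ 2 ≤ 2 ^ (5 * a) * a.factorial := by
      obtain ⟨hPle, hboch⟩ := card_induced_le T B
      refine sq_le_two_pow_five_mul_factorial hPle ?_
      rcases hI with h | h
      · exact Or.inl h
      · exact Or.inr (hboch hPprim h)
    have hKP : Nat.card K ≤ Nat.card P ^ b := est_card_kernel_le_pow T B hBne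
    refine single _ le_rfl ?_
    calc Nat.card X * Nat.card Y
        ≤ (b.factorial * Nat.card K) * (b.factorial * Nat.card K) :=
          Nat.mul_le_mul (hXK.trans (Nat.mul_le_mul_left _ (card_le_of_le inf_le_right)))
            (hYK.trans (Nat.mul_le_mul_left _ (card_le_of_le inf_le_right)))
      _ = b.factorial ^ 2 * Nat.card K ^ 2 := by ring
      _ ≤ b.factorial ^ 2 * (Nat.card P ^ b) ^ 2 := Nat.mul_le_mul_left _ (Nat.pow_le_pow_left hKP 2)
      _ = b.factorial ^ 2 * (Nat.card P ^ 2) ^ b := by rw [← pow_mul, ← pow_mul, mul_comm b 2]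
      _ ≤ b.factorial ^ 2 * (2 ^ (5 * a) * a.factorial) ^ b :=
          Nat.mul_le_mul_left _ (Nat.pow_le_pow_left hP2 b)
      _ = 2 ^ (5 * (a * b)) * (a.factorial ^ b * b.factorial ^ 2) := by rw [mul_pow, ← pow_mul]; ring
      _ ≤ 2 ^ (5 * d) * d.factorial := by rw [hab]; exact Nat.mul_le_mul_left _ hA1
  ------------------------------------------------------------------ case II: `Alt(B) ≤ P`, `a ≥ 5`
  push Not at hI
  obtain ⟨ha4, hAlt⟩ := hI
  have ha5 : 5 ≤ B.card := ha4
  have hTBT : TB ≤ T := fun t ht => ((mem_stabilizer_map_iff T B t).1 ht).1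
  have hTBfull := stabilizer_full_of_alternating_le T B hAlt
  have hKinvB : ∀ k ∈ K, ∀ u, k u ∈ B ↔ u ∈ B := fun k hk => kernel_apply_mem_iff T B hk (mem_orbit_self B)
  have hnorm : ∀ (S : Subgroup (Perm β)), (∀ t ∈ T, ∀ s ∈ S, t * s * t⁻¹ ∈ S) →
      ∀ t ∈ T, ∀ s ∈ S ⊓ K, t * s * t⁻¹ ∈ S ⊓ K := fun S nS t ht s hs =>
    Subgroup.mem_inf.2 ⟨nS t ht s (Subgroup.mem_inf.1 hs).1, conj_mem_kernel T B ht (Subgroup.mem_inf.1 hs).2⟩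
  -- dichotomy for `X ∩ K` and `Y ∩ K` on `B`
  have hdich : ∀ (S : Subgroup (Perm β)), (∀ t ∈ T, ∀ s ∈ S, t * s * t⁻¹ ∈ S) →
      (∀ s ∈ S ⊓ K, ∀ u ∈ B, s u = u) ∨
        ∀ σ : Perm β, sign σ = 1 → (∀ u, σ u ≠ u → u ∈ B) → ∃ s ∈ S ⊓ K, ∀ u ∈ B, s u = σ u :=
    fun S nS => est_trivial_or_full_of_normal B TB (S ⊓ K) ha5 (stabilizer_apply_mem_iff T B)
      (fun m hm => hKinvB m (Subgroup.mem_inf.1 hm).2) hTBfull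
      (fun l hl m hm => hnorm S nS l (hTBT hl) m hm)
  -- a subgroup of `K` trivial on `B` is trivial
  have htriv : ∀ (S : Subgroup (Perm β)), (∀ t ∈ T, ∀ s ∈ S, t * s * t⁻¹ ∈ S) →
      (∀ s ∈ S ⊓ K, ∀ u ∈ B, s u = u) → Nat.card ↥(S ⊓ K) = 1 := by
    intro S nS hS
    have hall := transport_trivial T B (S ⊓ K) (hnorm S nS) hS
    rw [Subgroup.card_eq_one, Subgroup.eq_bot_iff_forall]
    intro s hs
    ext u
    obtain ⟨C, hC, hu⟩ := exists_mem_translate T B hBne u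
    exact hall C hC s hs u hu
  rcases hdich X nX with hXtriv | hXfull
  · refine single _ le_rfl ?_
    calc Nat.card X * Nat.card Y ≤ (b.factorial * Nat.card ↥(X ⊓ K)) * (b.factorial * Nat.card ↥(Y ⊓ K)) :=
          Nat.mul_le_mul hXK hYK
      _ ≤ 2 ^ (5 * d) * d.factorial := by
          refine hsmall _ _ ?_ (hKa _ inf_le_right) ?_
          · rw [htriv X nX hXtriv]; exact Nat.one_le_pow _ _ (Nat.factorial_pos a)
          · rw [htriv X nX hXtriv, one_mul]; exact hKa _ inf_le_right
  rcases hdich Y nY with hYtriv | hYfull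
  · refine single _ le_rfl ?_
    calc Nat.card X * Nat.card Y ≤ (b.factorial * Nat.card ↥(X ⊓ K)) * (b.factorial * Nat.card ↥(Y ⊓ K)) :=
          Nat.mul_le_mul hXK hYK
      _ ≤ 2 ^ (5 * d) * d.factorial := by
          refine hsmall _ _ (hKa _ inf_le_right) ?_ ?_
          · rw [htriv Y nY hYtriv]; exact Nat.one_le_pow _ _ (Nat.factorial_pos a)
          · rw [htriv Y nY hYtriv, mul_one]; exact hKa _ inf_le_right
  -- both full on `B`, hence on every translate
  have hXfullC := est_transport_full T B (X ⊓ K) (hnorm X nX) hXfull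
  have hYfullC := est_transport_full T B (Y ⊓ K) (hnorm Y nY) hYfull
  have hcK : ∀ x ∈ X ⊓ K, ∀ y ∈ Y ⊓ K, x * y * x⁻¹ * y⁻¹ ∈ Z ⊓ K := by
    intro x hx y hy
    obtain ⟨hxX, hxK⟩ := Subgroup.mem_inf.1 hx
    obtain ⟨hyY, hyK⟩ := Subgroup.mem_inf.1 hy
    exact Subgroup.mem_inf.2 ⟨hc x hxX y hyY,
      K.mul_mem (K.mul_mem (K.mul_mem hxK hyK) (K.inv_mem hxK)) (K.inv_mem hyK)⟩
  -- the elements of `Z ∩ K` supported in `B`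
  set MZ := (Z ⊓ K) ⊓ fixingSubgroup (Perm β) ((B : Set β)ᶜ) with hMZ
  have hmemMZ : ∀ z, z ∈ MZ ↔ (z ∈ Z ∧ z ∈ K) ∧ ∀ u, u ∉ B → z u = u := by
    intro z
    rw [hMZ, Subgroup.mem_inf, Subgroup.mem_inf, mem_fixingSubgroup_iff]
    simp only [Set.mem_compl_iff, Finset.mem_coe, Perm.smul_def]
  have hMZnorm : ∀ t ∈ TB, ∀ m ∈ MZ, t * m * t⁻¹ ∈ MZ := by
    intro t ht m hm
    rw [hmemMZ] at hm ⊢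
    refine ⟨Subgroup.mem_inf.1 (hnorm Z nZ t (hTBT ht) m (Subgroup.mem_inf.2 hm.1)), fun u hu => ?_⟩
    have h1 : t⁻¹ u ∉ B := fun h => hu (by
      have := stabilizer_apply_mem_iff T B t ht (t⁻¹ u)
      rw [perm_apply_inv_self] at this
      exact this.2 h)
    rw [Perm.mul_apply, Perm.mul_apply, hm.2 _ h1, perm_apply_inv_self]
  rcases est_trivial_or_full_of_normal B TB MZ ha5 (stabilizer_apply_mem_iff T B)
      (fun m hm => hKinvB m ((hmemMZ m).1 hm).1.2) hTBfull hMZnorm with hZtriv | hZfull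
  · ---------------------------------------------------------------- no rigid elements: linkage
    have hrig : ∀ z ∈ Z ⊓ K, (∀ u, u ∉ B → z u = u) → z = 1 := by
      intro z hz hzB
      ext u
      by_cases hu : u ∈ B
      · exact hZtriv z ((hmemMZ z).2 ⟨Subgroup.mem_inf.1 hz, hzB⟩) u hu
      · exact hzB u hu
    have hrigC := transport_rigid_trivial T B (Z ⊓ K) (hnorm Z nZ) hrig
    set I := (orbit T B).toFinset with hI
    have hIcard : I.card = b := by rw [hI, Set.toFinset_card, ← Nat.card_eq_fintype_card]
    have hmemI : ∀ C, C ∈ I ↔ C ∈ orbit T B := fun C => Set.mem_toFinset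
    have link : ∀ U V : Subgroup (Perm β), U ≤ K → V ≤ K →
        (∀ C ∈ orbit T B, ∀ σ : Perm β, sign σ = 1 → (∀ u, σ u ≠ u → u ∈ C) →
          ∃ y ∈ V, ∀ u ∈ C, y u = σ u) →
        (∀ C ∈ orbit T B, ∀ σ : Perm β, sign σ = 1 → (∀ u, σ u ≠ u → u ∈ C) →
          ∃ x ∈ U, ∀ u ∈ C, x u = σ u) →
        (∀ x ∈ U, ∀ y ∈ V, x * y * x⁻¹ * y⁻¹ ∈ Z ⊓ K) → Nat.card U ^ 2 ≤ a.factorial ^ b := by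
      intro U V hUK hVK hVfullC hUfullC hcUV
      have hno := est_no_rigid_of_commutator T B (by omega) U V (Z ⊓ K) hUK hVK hVfullC hcUV hrigC
      exact est_linkage_sq_le_of_no_good a b I U ha5 hIcard
        (fun C hC => card_eq_of_mem_orbit T B ((hmemI C).1 hC))
        (fun x hx C hC => kernel_apply_mem_iff T B (hUK hx) ((hmemI C).1 hC))
        (fun x hx hxt => by
          ext u
          obtain ⟨C, hC, hu⟩ := exists_mem_translate T B hBne u
          exact hxt C ((hmemI C).2 hC) u hu)
        (fun C hC => Or.inr (hUfullC C ((hmemI C).1 hC)))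
        (fun C hC x hxU hx1 hxt => hno C ((hmemI C).1 hC) x hxU hx1 fun u hu => by
          obtain ⟨C', hC', hu'⟩ := exists_mem_translate T B hBne u
          exact hxt C' ((hmemI C').2 hC') (fun h => hu (h ▸ hu')) u hu')
    have hXsq := link (X ⊓ K) (Y ⊓ K) inf_le_right inf_le_right hYfullC hXfullC hcK
    have hYsq := link (Y ⊓ K) (X ⊓ K) inf_le_right inf_le_right hXfullC hYfullC (fun y hy x hx => by
      have := (Z ⊓ K).inv_mem (hcK x hx y hy)
      have e : (x * y * x⁻¹ * y⁻¹)⁻¹ = y * x * y⁻¹ * x⁻¹ := by group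
      rwa [e] at this)
    have hXY : Nat.card ↥(X ⊓ K) * Nat.card ↥(Y ⊓ K) ≤ a.factorial ^ b := by
      have : (Nat.card ↥(X ⊓ K) * Nat.card ↥(Y ⊓ K)) ^ 2 ≤ (a.factorial ^ b) ^ 2 := by
        rw [mul_pow, pow_two (a.factorial ^ b)]; exact Nat.mul_le_mul hXsq hYsq
      exact (Nat.pow_le_pow_iff_left (by norm_num)).1 this
    refine single _ le_rfl ?_
    calc Nat.card X * Nat.card Y ≤ (b.factorial * Nat.card ↥(X ⊓ K)) * (b.factorial * Nat.card ↥(Y ⊓ K)) :=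
          Nat.mul_le_mul hXK hYK
      _ ≤ 2 ^ (5 * d) * d.factorial := hsmall _ _ (hKa _ inf_le_right) (hKa _ inf_le_right) hXY
  · ---------------------------------------------------------------- classes = translates
    have hZB : ∀ σ : Perm β, sign σ = 1 → (∀ u, σ u ≠ u → u ∈ B) → σ ∈ Z := by
      intro σ hσ hσB
      obtain ⟨m, hm, hmσ⟩ := hZfull σ hσ hσB
      have e : m = σ := by
        ext u
        by_cases hu : u ∈ B
        · exact hmσ u hu
        · rw [((hmemMZ m).1 hm).2 u hu, apply_eq_self_of_not_mem hσB u hu]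
      rw [← e]; exact ((hmemMZ m).1 hm).1.1
    have hZC := est_transport_rigid_full T B Z nZ hZB
    set I := (orbit T B).toFinset with hI
    have hIcard : I.card = b := by rw [hI, Set.toFinset_card, ← Nat.card_eq_fintype_card]
    have hmemI : ∀ C, C ∈ I ↔ C ∈ orbit T B := fun C => Set.mem_toFinset
    obtain ⟨μ, hμlt, hμclass, hμprod⟩ := exists_block_labelling I a
      (fun C hC => card_eq_of_mem_orbit T B ((hmemI C).1 hC))
      (fun u => by
        obtain ⟨C, hC, hu⟩ := exists_mem_translate T B hBne u
        exact ⟨C, (hmemI C).2 hC, hu⟩)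
      (fun C hC C' hC' hne => (eq_or_disjoint_of_mem_orbit T B hB ((hmemI C).1 hC)
        ((hmemI C').1 hC')).resolve_left hne)
    rw [hIcard] at hμlt hμclass hμprod
    refine ⟨b, μ, hμlt, fun σ hσ hσμ => ?_, ?_⟩
    · by_cases h1 : σ = 1
      · rw [h1]; exact Z.one_mem
      obtain ⟨u₀, hu₀⟩ : ∃ u, σ u ≠ u := by
        by_contra h
        push Not at h
        exact h1 (Equiv.ext h)
      obtain ⟨C, hCI, hCclass⟩ := hμclass (μ u₀) (hμlt u₀)
      exact hZC C ((hmemI C).1 hCI) σ hσ fun u hu => (hCclass u).1 (hσμ u u₀ hu hu₀)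
    · calc Nat.card X * Nat.card Y
          ≤ (b.factorial * Nat.card ↥(X ⊓ K)) * (b.factorial * Nat.card ↥(Y ⊓ K)) := Nat.mul_le_mul hXK hYK
        _ ≤ (b.factorial * a.factorial ^ b) * (b.factorial * a.factorial ^ b) :=
            Nat.mul_le_mul (Nat.mul_le_mul_left _ (hKa _ inf_le_right))
              (Nat.mul_le_mul_left _ (hKa _ inf_le_right))
        _ = (a.factorial ^ b * b.factorial ^ 2) * a.factorial ^ b := by ring
        _ ≤ d.factorial * a.factorial ^ b := Nat.mul_le_mul_right _ hA1
        _ ≤ 2 ^ (5 * d) * d.factorial * a.factorial ^ b :=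
            Nat.mul_le_mul_right _ (Nat.le_mul_of_pos_left _ (Nat.pow_pos (by norm_num)))
        _ = _ := by rw [hμprod]

end Summit.PneNP.PneNP.Theorems
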